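import Mathlib
import Literature.Computability.AlgebraicComplexity.SimultaneousDoubleProduct
import Literature.Computability.AlgebraicComplexity.ChartUSP
import Summits.MatrixMultiplication.MatrixMultiplication.Theorems.EisensteinValCertificatesHomocyclicSTPPDesignsStubLeafPacking

/-!
# Capacity of the rotated two-family chart (line `registered` of crux `EisensteinValCertificates.HomocyclicSTPPDesigns`,
stmt-MatrixMultiplication-10647; lead c4, `--supports`)

Line `registered` (`Cruxes/HomocyclicSTPPDesigns/Lines/clustered_charts.lean`) builds homocyclic STPP designs
from an SDPP family `(A_t, B_t)_{t<n}` (tree `IsSDPP`) through the ROTATED TWO-FAMILY CHART of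
Cohn–Kleinberg–Szegedy–Umans 2005, §6.2: symbols `Fin n × Fin 3`,
`(t,0) ↦ (A_t, B_t, {0})`, `(t,1) ↦ ({0}, A_t, B_t)`, `(t,2) ↦ (B_t, {0}, A_t)`, and CKSU Thm. 37
(tree `CohnKleinbergSzegedyUmans2005_thm37`): a local chart-USP of `L` rows of width `k` (tree
`IsLocalChartUSP`) gives an STPP family of `L` blocks of volume `(ab)^k` (`|A_t| = a`, `|B_t| = b`).

This file bounds the number of rows of ANY local chart-USP over this chart, in a finite abelian group `H`
(the chart maps are abstract functions on `Fin n × Fin 3` pinned down by their nine values, as in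
`…StubRowsDesign.lean`):

* `chartCapacity_rows_le` — fixed role layout `row u c = (sym u c, role c)`: for each role `r`,
  `L · (ab)^{k_r} ≤ n^{k'_r} · |H|^{k_r}`, where `k_r` (`k'_r`) counts the coordinates of role `r` (`≠ r`).
  Proof: for rows `u ≠ v` the test triple `(u,v,u)` (r = 0), `(u,u,v)` (r = 1), `(v,u,u)` (r = 2) is BAD
  at a coordinate of role `≠ r` as soon as `sym u c = sym v c`, and at a coordinate of role `r` as soon as
  the difference sets `(A − B)(sym u c)`, `(A − B)(sym v c)` meet (`chartCapacity_separates`); so the pairs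
  `(u, x)`, `x ∈ ∏_{role c = r} (A − B)(sym u c)`, inject into `(symbols off r) × H^{k_r}` — a double count;
* `chartCapacity_rows_cube_le` — multiplying the three: `L³ · (ab)^k ≤ n^{2k} · |H|^k`, i.e.
  `L ≤ (n² |H| / ab)^{k/3}` whatever the layout and the rows;
* `chartCapacity_cube` — the registered closed form in `ℤ/p` (crux stub of stmt-10647).

The companion file `…ChartCapacityDensity.lean` adds arbitrary rows (roles mixed per row and coordinate:
`L³ · (ab)^k ≤ 27^k · n^{2k} · |H|^k`, fibring over the `3^k` role words) and the statement used by the crux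
analysis (`Cruxes/HomocyclicSTPPDesigns/CHART-CAPACITY.md`): blocks over this chart beating exponent `2 + ε`
force `|H|² < [27] n² (ab)^{1+ε}` — dense SDPP families are necessary for the whole mechanism, so the open
leaf `stub_clusteredTwoFamilies` cannot be reshaped to a sparser one inside the line.

Sources for the notions: H. Cohn, R. Kleinberg, B. Szegedy, C. Umans, *Group-theoretic algorithms for matrix
multiplication*, FOCS 2005 = arXiv:math/0511460, §4 Def. 4.1 (SDPP), §6.2 Def. 36 / Thm. 37 (charts);
K. Pratt, *On generalized corners and matrix multiplication*, ITCS 2024, §4.  The bound is the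
fractional-clique-cover estimate for the intersection graph of the difference sets; nothing is cited as a fact.
-/

set_option linter.dupNamespace false
-- (single-conjunct summit: the namespace repeats `MatrixMultiplication`)

namespace Summit.MatrixMultiplication.MatrixMultiplication.Theorems.HomocyclicSTPPDesigns.ClusteredCharts

open Literature.Computability.AlgebraicComplexity Finset
open scoped Pointwise

section Chart

variable {H : Type*} [AddCommGroup H] [DecidableEq H] {n : ℕ} {A B : Fin n → Finset H}
  {cA cB cC : Fin n × Fin 3 → Finset H}

/-- The three elements of `Fin 3`. [folklore] -/
private theorem chartCapacity_fin3 : ∀ r : Fin 3, r = 0 ∨ r = 1 ∨ r = 2 := by decide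

/-- A repeated symbol is always bad: `0 ∈ (S − S) + (T − T) + (U − U)` for non-empty `S, T, U`.
[folklore] -/
private theorem chartCapacity_bad_same {S T U : Finset H} (hS : S.Nonempty) (hT : T.Nonempty)
    (hU : U.Nonempty) : (0 : H) ∈ (S - S) + (T - T) + (U - U) := by
  obtain ⟨s, hs⟩ := hS
  obtain ⟨t, ht⟩ := hT
  obtain ⟨u, hu⟩ := hU
  have h : (0 : H) = (s - s) + (t - t) + (u - u) := by simp
  rw [h]
  exact Finset.add_mem_add (Finset.add_mem_add (Finset.sub_mem_sub hs hs)
    (Finset.sub_mem_sub ht ht)) (Finset.sub_mem_sub hu hu)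

/-- A common difference makes the role-`r` test pattern bad: if `A t − B t` meets `A t' − B t'` then
`0 ∈ (A t − A t') + (B t' − B t) + ({0} − {0})` (the relation set, up to the order of the three
summands, of the symbol triples `((t,0),(t',0),(t,0))`, `((t,1),(t,1),(t',1))`, `((t',2),(t,2),(t,2))`).
[folklore] -/
private theorem chartCapacity_bad_common {t t' : Fin n}
    (h : ¬ Disjoint (A t - B t) (A t' - B t')) :
    (0 : H) ∈ (A t - A t') + (B t' - B t) + (({0} : Finset H) - {0}) := by
  rw [Finset.not_disjoint_iff] at h
  obtain ⟨d, hd, hd'⟩ := h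
  rw [Finset.mem_sub] at hd hd'
  obtain ⟨α, hα, β, hβ, rfl⟩ := hd
  obtain ⟨α', hα', β', hβ', he⟩ := hd'
  have h0 : (α - α') + (β' - β) + ((0 : H) - 0) = 0 := by
    have : (α - α') + (β' - β) = (α - β) - (α' - β') := by abel
    rw [sub_zero, add_zero, this, he, sub_self]
  have hm : (α - α') + (β' - β) + ((0 : H) - 0) ∈
      (A t - A t') + (B t' - B t) + (({0} : Finset H) - {0}) :=
    Finset.add_mem_add (Finset.add_mem_add (Finset.sub_mem_sub hα hα')
      (Finset.sub_mem_sub hβ' hβ)) (Finset.sub_mem_sub (Finset.mem_singleton_self (0 : H))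
        (Finset.mem_singleton_self (0 : H)))
  rw [h0] at hm
  exact hm

/-- **No two rows of a fixed-layout local chart-USP over the rotated chart agree off role `r` while their
role-`r` difference sets pairwise meet.**  For `u ≠ v` the test triple `(u,v,u)` / `(u,u,v)` / `(v,u,u)`
(for `r = 0 / 1 / 2`) would be bad at every coordinate. [folklore] -/
private theorem chartCapacity_separates {a b : ℕ} (ha : 1 ≤ a) (hb : 1 ≤ b)
    (hcard : ∀ i, (A i).card = a ∧ (B i).card = b)
    (hA0 : ∀ i, cA (i, 0) = A i) (hA1 : ∀ i, cA (i, 1) = {0}) (hA2 : ∀ i, cA (i, 2) = B i)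
    (hB0 : ∀ i, cB (i, 0) = B i) (hB1 : ∀ i, cB (i, 1) = A i) (hB2 : ∀ i, cB (i, 2) = {0})
    (hC0 : ∀ i, cC (i, 0) = {0}) (hC1 : ∀ i, cC (i, 1) = B i) (hC2 : ∀ i, cC (i, 2) = A i)
    {k L : ℕ} (role : Fin k → Fin 3) (sym : Fin L → Fin k → Fin n)
    (hU : IsLocalChartUSP cA cB cC (fun u c => (sym u c, role c)))
    (r : Fin 3) {u v : Fin L} (huv : u ≠ v)
    (hoff : ∀ c, role c ≠ r → sym u c = sym v c)
    (hon : ∀ c, role c = r → ¬ Disjoint (A (sym u c) - B (sym u c)) (A (sym v c) - B (sym v c))) :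
    False := by
  have hAne : ∀ i, (A i).Nonempty := fun i =>
    Finset.card_pos.1 (by rw [(hcard i).1]; exact ha)
  have hBne : ∀ i, (B i).Nonempty := fun i =>
    Finset.card_pos.1 (by rw [(hcard i).2]; exact hb)
  -- every symbol has non-empty chart sets
  have hne : ∀ x : Fin n × Fin 3, (cA x).Nonempty ∧ (cB x).Nonempty ∧ (cC x).Nonempty := by
    rintro ⟨i, s⟩
    rcases chartCapacity_fin3 s with rfl | rfl | rfl
    · rw [hA0, hB0, hC0]; exact ⟨hAne i, hBne i, Finset.singleton_nonempty _⟩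
    · rw [hA1, hB1, hC1]; exact ⟨Finset.singleton_nonempty _, hAne i, hBne i⟩
    · rw [hA2, hB2, hC2]; exact ⟨hBne i, Finset.singleton_nonempty _, hAne i⟩
  -- a coordinate where the symbols of `u` and `v` coincide is bad for any arrangement of `u`'s and `v`'s
  have hsame : ∀ c, sym u c = sym v c → ∀ x y z : Fin L, (x = u ∨ x = v) → (y = u ∨ y = v) →
      (z = u ∨ z = v) → ((sym x c, role c), (sym y c, role c), (sym z c, role c)) ∉
        chartHypergraph cA cB cC := by
    intro c hc x y z hx hy hz hmem
    rw [mem_chartHypergraph_iff] at hmem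
    have ex : sym x c = sym u c := by rcases hx with rfl | rfl <;> [rfl; exact hc.symm]
    have ey : sym y c = sym u c := by rcases hy with rfl | rfl <;> [rfl; exact hc.symm]
    have ez : sym z c = sym u c := by rcases hz with rfl | rfl <;> [rfl; exact hc.symm]
    rw [ex, ey, ez] at hmem
    obtain ⟨h1, h2, h3⟩ := hne (sym u c, role c)
    exact hmem (chartCapacity_bad_same h1 h2 h3)
  rcases chartCapacity_fin3 r with rfl | rfl | rfl
  · -- r = 0: test triple (u, v, u)
    obtain ⟨c, hc⟩ := hU u v u (fun h => huv h.1)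
    dsimp only at hc
    by_cases hr : role c = 0
    · rw [mem_chartHypergraph_iff, hr] at hc
      simp only [hA0, hB0, hC0] at hc
      exact hc (chartCapacity_bad_common (hon c hr))
    · exact hsame c (hoff c hr) u v u (Or.inl rfl) (Or.inr rfl) (Or.inl rfl) hc
  · -- r = 1: test triple (u, u, v)
    obtain ⟨c, hc⟩ := hU u u v (fun h => huv h.2)
    dsimp only at hc
    by_cases hr : role c = 1
    · rw [mem_chartHypergraph_iff, hr] at hc
      simp only [hA1, hB1, hC1] at hc
      refine hc ?_
      have h := chartCapacity_bad_common (hon c hr)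
      -- reorder the three summands: ({0}-{0}) + (A-A') + (B'-B)
      have e : (({0} : Finset H) - {0}) + (A (sym u c) - A (sym v c)) + (B (sym v c) - B (sym u c)) =
          (A (sym u c) - A (sym v c)) + (B (sym v c) - B (sym u c)) + (({0} : Finset H) - {0}) := by
        ac_rfl
      rw [e]; exact h
    · exact hsame c (hoff c hr) u u v (Or.inl rfl) (Or.inl rfl) (Or.inr rfl) hc
  · -- r = 2: test triple (v, u, u)
    obtain ⟨c, hc⟩ := hU v u u (fun h => huv h.1.symm)
    dsimp only at hc
    by_cases hr : role c = 2
    · rw [mem_chartHypergraph_iff, hr] at hc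
      simp only [hA2, hB2, hC2] at hc
      refine hc ?_
      have h := chartCapacity_bad_common (hon c hr)
      have e : (B (sym v c) - B (sym u c)) + (({0} : Finset H) - {0}) + (A (sym u c) - A (sym v c)) =
          (A (sym u c) - A (sym v c)) + (B (sym v c) - B (sym u c)) + (({0} : Finset H) - {0}) := by
        ac_rfl
      rw [e]; exact h
    · exact hsame c (hoff c hr) v u u (Or.inr rfl) (Or.inl rfl) (Or.inl rfl) hc


/-- **Capacity of the rotated two-family chart, one role at a time** (Theorem A_r of the crux note
`Cruxes/HomocyclicSTPPDesigns/CHART-CAPACITY.md`).  Over an SDPP family `(A_t, B_t)_{t<n}` in a finite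
abelian group `H` with `|A_t| = a ≥ 1`, `|B_t| = b ≥ 1`, every local chart-USP over the rotated chart with a
fixed role layout `row u c = (sym u c, role c)` has, for each role `r`,
`L · (ab)^{k_r} ≤ n^{k'_r} · |H|^{k_r}`, where `k_r = #{c : role c = r}` and `k'_r = #{c : role c ≠ r}`.
Proof: the pairs `(u, x)` with `x ∈ ∏_{role c = r} (A − B)(sym u c)` (and `x c = 0` elsewhere) inject, by
`(u, x) ↦ (c ↦ sym u c off r, x c on r)`, into a set of size `n^{k'_r} |H|^{k_r}`: equal images give rows
agreeing off `r` with pairwise meeting role-`r` difference sets, which `chartCapacity_separates` excludes.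
[folklore] -/
theorem chartCapacity_rows_le [Fintype H] {a b : ℕ} (hS : IsSDPP A B) (ha : 1 ≤ a) (hb : 1 ≤ b)
    (hcard : ∀ i, (A i).card = a ∧ (B i).card = b)
    (hA0 : ∀ i, cA (i, 0) = A i) (hA1 : ∀ i, cA (i, 1) = {0}) (hA2 : ∀ i, cA (i, 2) = B i)
    (hB0 : ∀ i, cB (i, 0) = B i) (hB1 : ∀ i, cB (i, 1) = A i) (hB2 : ∀ i, cB (i, 2) = {0})
    (hC0 : ∀ i, cC (i, 0) = {0}) (hC1 : ∀ i, cC (i, 1) = B i) (hC2 : ∀ i, cC (i, 2) = A i)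
    {k L : ℕ} (role : Fin k → Fin 3) (sym : Fin L → Fin k → Fin n)
    (hU : IsLocalChartUSP cA cB cC (fun u c => (sym u c, role c))) (r : Fin 3) :
    L * (a * b) ^ (Finset.univ.filter fun c => role c = r).card ≤
      n ^ (Finset.univ.filter fun c => role c ≠ r).card *
        Fintype.card H ^ (Finset.univ.filter fun c => role c = r).card := by
  classical
  -- source: pairs `(u, x)` with `x c ∈ (A − B)(sym u c)` on role `r` and `x c = 0` off role `r`
  set F : Fin L → Fin k → Finset H := fun u c =>
    if role c = r then A (sym u c) - B (sym u c) else {0} with hF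
  set S : Finset (Σ _ : Fin L, Fin k → H) :=
    Finset.univ.sigma fun u => Fintype.piFinset (F u) with hSdef
  -- target: `c ↦ inl (symbol)` off role `r`, `c ↦ inr (group element)` on role `r`
  set G : Fin k → Finset (Fin n ⊕ H) := fun c =>
    if role c = r then (Finset.univ : Finset H).map Function.Embedding.inr
    else (Finset.univ : Finset (Fin n)).map Function.Embedding.inl with hG
  set T : Finset (Fin k → Fin n ⊕ H) := Fintype.piFinset G with hTdef
  set φ : (Σ _ : Fin L, Fin k → H) → (Fin k → Fin n ⊕ H) := fun q c =>
    if role c = r then Sum.inr (q.2 c) else Sum.inl (sym q.1 c) with hφ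
  have hcardS : S.card = L * (a * b) ^ (univ.filter fun c => role c = r).card := by
    rw [hSdef, Finset.card_sigma]
    have hu : ∀ u ∈ (univ : Finset (Fin L)),
        (Fintype.piFinset (F u)).card = (a * b) ^ (univ.filter fun c => role c = r).card := by
      intro u _
      rw [Fintype.card_piFinset]
      have hc : ∀ c, (F u c).card = if role c = r then a * b else 1 := by
        intro c
        simp only [hF]
        split_ifs with h
        · rw [leafPacking_card_sub hS, (hcard _).1, (hcard _).2]
        · rfl
      simp_rw [hc]
      rw [Finset.prod_ite, Finset.prod_const, Finset.prod_const_one, mul_one]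
    rw [Finset.sum_congr rfl hu, Finset.sum_const, Finset.card_univ, Fintype.card_fin, smul_eq_mul]
  have hcardT : T.card = n ^ (univ.filter fun c => role c ≠ r).card *
      Fintype.card H ^ (univ.filter fun c => role c = r).card := by
    rw [hTdef, Fintype.card_piFinset]
    have hc : ∀ c, (G c).card = if role c = r then Fintype.card H else n := by
      intro c
      simp only [hG]
      split_ifs
      · rw [Finset.card_map, Finset.card_univ]
      · rw [Finset.card_map, Finset.card_univ, Fintype.card_fin]
    simp_rw [hc]
    rw [Finset.prod_ite, Finset.prod_const, Finset.prod_const, mul_comm]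
  rw [← hcardS, ← hcardT]
  refine Finset.card_le_card_of_injOn φ (fun q _ => ?_) ?_
  · -- maps into `T`
    rw [Finset.mem_coe, hTdef, Fintype.mem_piFinset]
    intro c
    simp only [hφ, hG]
    split_ifs
    · exact Finset.mem_map_of_mem _ (Finset.mem_univ _)
    · exact Finset.mem_map_of_mem _ (Finset.mem_univ _)
  · -- injective on `S`
    rintro ⟨u, x⟩ hux ⟨v, y⟩ hvy he
    rw [Finset.mem_coe, hSdef, Finset.mem_sigma, Fintype.mem_piFinset] at hux hvy
    have hec : ∀ c, φ ⟨u, x⟩ c = φ ⟨v, y⟩ c := fun c => congrFun he c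
    have hon' : ∀ c, role c = r → x c = y c := by
      intro c hc
      have h := hec c
      simp only [hφ, hc, if_true] at h
      exact Sum.inr_injective h
    have hoff' : ∀ c, role c ≠ r → sym u c = sym v c := by
      intro c hc
      have h := hec c
      simp only [hφ, hc, if_false] at h
      exact Sum.inl_injective h
    have huv : u = v := by
      by_contra huv
      refine chartCapacity_separates ha hb hcard hA0 hA1 hA2 hB0 hB1 hB2 hC0 hC1 hC2 role sym hU r
        huv hoff' fun c hc => ?_
      rw [Finset.not_disjoint_iff]
      refine ⟨x c, ?_, ?_⟩
      · have h := hux.2 c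
        simp only [hF, hc, if_true] at h
        exact h
      · have h := hvy.2 c
        rw [hon' c hc]
        simp only [hF, hc, if_true] at h
        exact h
    subst huv
    have hxy : x = y := by
      funext c
      by_cases hc : role c = r
      · exact hon' c hc
      · have h1 := hux.2 c
        have h2 := hvy.2 c
        simp only [hF, hc, if_false, Finset.mem_singleton] at h1 h2
        rw [h1, h2]
    subst hxy
    rfl


/-- **Capacity of the rotated two-family chart** (Theorem A of `CHART-CAPACITY.md`): multiplying the three
role-wise bounds of `chartCapacity_rows_le`, every fixed-layout local chart-USP over the rotated chart of an
SDPP family has `L³ · (ab)^k ≤ n^{2k} · |H|^k`, i.e. at most `(n² |H| / ab)^{k/3}` rows — whatever the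
layout and whatever the rows (class words × corner-free squares in the line, or anything else). [folklore] -/
theorem chartCapacity_rows_cube_le [Fintype H] {a b : ℕ} (hS : IsSDPP A B) (ha : 1 ≤ a) (hb : 1 ≤ b)
    (hcard : ∀ i, (A i).card = a ∧ (B i).card = b)
    (hA0 : ∀ i, cA (i, 0) = A i) (hA1 : ∀ i, cA (i, 1) = {0}) (hA2 : ∀ i, cA (i, 2) = B i)
    (hB0 : ∀ i, cB (i, 0) = B i) (hB1 : ∀ i, cB (i, 1) = A i) (hB2 : ∀ i, cB (i, 2) = {0})
    (hC0 : ∀ i, cC (i, 0) = {0}) (hC1 : ∀ i, cC (i, 1) = B i) (hC2 : ∀ i, cC (i, 2) = A i)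
    {k L : ℕ} (role : Fin k → Fin 3) (sym : Fin L → Fin k → Fin n)
    (hU : IsLocalChartUSP cA cB cC (fun u c => (sym u c, role c))) :
    L ^ 3 * (a * b) ^ k ≤ n ^ (2 * k) * Fintype.card H ^ k := by
  classical
  have h0 := chartCapacity_rows_le hS ha hb hcard hA0 hA1 hA2 hB0 hB1 hB2 hC0 hC1 hC2 role sym hU 0
  have h1 := chartCapacity_rows_le hS ha hb hcard hA0 hA1 hA2 hB0 hB1 hB2 hC0 hC1 hC2 role sym hU 1
  have h2 := chartCapacity_rows_le hS ha hb hcard hA0 hA1 hA2 hB0 hB1 hB2 hC0 hC1 hC2 role sym hU 2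
  -- the role counts
  have hsum : (univ.filter fun c => role c = 0).card + (univ.filter fun c => role c = 1).card +
      (univ.filter fun c => role c = 2).card = k := by
    have h := Finset.card_eq_sum_card_fiberwise (f := role) (s := (univ : Finset (Fin k)))
      (t := (univ : Finset (Fin 3))) (fun x _ => Finset.mem_coe.2 (Finset.mem_univ _))
    rw [Finset.card_univ, Fintype.card_fin, Fin.sum_univ_three] at h
    exact h.symm
  have hcomp : ∀ r : Fin 3, (univ.filter fun c => role c = r).card +
      (univ.filter fun c => role c ≠ r).card = k := by
    intro r
    have h := Finset.card_filter_add_card_filter_not (s := (univ : Finset (Fin k)))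
      (fun c => role c = r)
    rw [Finset.card_univ, Fintype.card_fin] at h
    exact h
  have e0 := hcomp 0
  have e1 := hcomp 1
  have e2 := hcomp 2
  set k0 := (univ.filter fun c => role c = 0).card
  set k1 := (univ.filter fun c => role c = 1).card
  set k2 := (univ.filter fun c => role c = 2).card
  set l0 := (univ.filter fun c => role c ≠ 0).card
  set l1 := (univ.filter fun c => role c ≠ 1).card
  set l2 := (univ.filter fun c => role c ≠ 2).card
  have hsum' : l0 + l1 + l2 = 2 * k := by omega
  calc L ^ 3 * (a * b) ^ k
      = (L * (a * b) ^ k0) * (L * (a * b) ^ k1) * (L * (a * b) ^ k2) := by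
        rw [← hsum]; ring
    _ ≤ (n ^ l0 * Fintype.card H ^ k0) * (n ^ l1 * Fintype.card H ^ k1) *
          (n ^ l2 * Fintype.card H ^ k2) :=
        Nat.mul_le_mul (Nat.mul_le_mul h0 h1) h2
    _ = n ^ (2 * k) * Fintype.card H ^ k := by
        rw [← hsum', ← hsum]; ring



end Chart


section Registered

open Literature.Computability.AlgebraicComplexity

/-- **Registered form (crux stmt-MatrixMultiplication-10647, stub `chartCapacity_cube`)** of
`chartCapacity_rows_cube_le` in prime cyclic groups: every fixed-layout local chart-USP over the rotated
two-family chart of an SDPP family in `ℤ/p` with `|A_t| = a ≥ 1`, `|B_t| = b ≥ 1` has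
`L³ · (ab)^k ≤ n^{2k} · p^k`. [folklore] -/
theorem chartCapacity_cube :
    ∀ (p n a b k L : ℕ) (A B : Fin n → Finset (ZMod p)) (cA cB cC : Fin n × Fin 3 → Finset (ZMod p))
      (role : Fin k → Fin 3) (sym : Fin L → Fin k → Fin n), p.Prime → IsSDPP A B → 1 ≤ a → 1 ≤ b →
      (∀ i, (A i).card = a ∧ (B i).card = b) →
      (∀ i, cA (i, 0) = A i) → (∀ i, cA (i, 1) = {0}) → (∀ i, cA (i, 2) = B i) →
      (∀ i, cB (i, 0) = B i) → (∀ i, cB (i, 1) = A i) → (∀ i, cB (i, 2) = {0}) →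
      (∀ i, cC (i, 0) = {0}) → (∀ i, cC (i, 1) = B i) → (∀ i, cC (i, 2) = A i) →
      IsLocalChartUSP cA cB cC (fun u c => (sym u c, role c)) →
      L ^ 3 * (a * b) ^ k ≤ n ^ (2 * k) * p ^ k := by
  intro p n a b k L A B cA cB cC role sym hp hS ha hb hcard hA0 hA1 hA2 hB0 hB1 hB2 hC0 hC1 hC2 hU
  haveI : Fact p.Prime := ⟨hp⟩
  have h := chartCapacity_rows_cube_le hS ha hb hcard hA0 hA1 hA2 hB0 hB1 hB2 hC0 hC1 hC2 role sym hU
  rwa [ZMod.card] at h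

end Registered

end Summit.MatrixMultiplication.MatrixMultiplication.Theorems.HomocyclicSTPPDesigns.ClusteredCharts
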